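import Literature.Analysis.FluidPDE.TaoAveragedSobolev
import HarnessLib

/-!
# Symmetry of averaged Euler bilinear operators (Tao 2016, §1.1 and Theorem 1.5)

T. Tao, *Finite time blowup for an averaged three-dimensional Navier–Stokes equation*,
J. Amer. Math. Soc. **29** (2016), 601–674, arXiv:1402.0290v3 (held as `paper:arxiv-1402.0290`;
page and equation numbers are those of that text).

This file settles the status of the predicate
`Literature.Analysis.FluidPDE.Tao2016.AveragingDatum.IsSymmetric` of
`Literature/Analysis/FluidPDE/TaoAveragedSobolev.lean` ("`B̃(u,v) = B̃(v,u)` in `(H¹⁰_df)*`"):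

* It is a **hypothesis on the averaging datum** — the word "symmetric" in Theorem 1.5, p. 7:
  "There exists a *symmetric* averaged Euler bilinear operator `B̃` … obeying the cancellation
  property" — and **not** a property of every averaged Euler bilinear operator (1.12)/(1.13):
  Tao imposes no symmetry on the averaging measure `μ`, the rotations `Rⱼ` or the multipliers
  `mⱼ(D)` (p. 7, the paragraph before Theorem 1.5, which makes the same point for the
  cancellation property (1.16)). Informally, for the deterministic datum `mⱼ ≡ 1`, `Rⱼ = id`,
  `λ = (2, 1, 1)` symmetry would say `⟨B(Dil₂ u, v), w⟩ = ⟨B(u, Dil₂ v), w⟩` for all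
  `u, v, w ∈ H¹⁰_df`, which fails for compactly supported divergence-free fields with
  `supp u ∩ supp Dil₂ v = ∅` but `⟨B(Dil₂ u, v), w⟩ ≠ 0` (this counterexample is not formalised
  here). So there is no theorem `∀ 𝒜, 𝒜.IsSymmetric` to prove; `IsSymmetric` is (correctly) a
  definition.
* What *is* true, and is proved below without any analytic input:
  1. (`form_symm_of_measurePreserving`, `isSymmetric_of_measurePreserving`) an abstract
     criterion: if a measure-preserving measurable automorphism `σ` of `(Ω, μ)` exchanges the
     random operators of slots 1 and 2 of (1.12) and fixes slot 3, then `B̃` is symmetric — for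
     *all* `u, v, w ∈ L²`, by the symmetry `⟨B(u,v), w⟩ = ⟨B(v,u), w⟩` of the Euler form and the
     change of variables `θ ↦ σ θ`. (The same mechanism, in discrete form, is Tao's remark in §4,
     p. 21, that the symmetry `α_{i₁,i₂,i₃,μ₁,μ₂,μ₃} = α_{i₂,i₁,i₃,μ₂,μ₁,μ₃}` of the structure
     constants "ensures that `C` is symmetric".)
  2. (`isSymmetric_of_slot_eq`) the case `σ = id`: data whose slot-1 and slot-2 operators agree
     samplewise are symmetric; e.g. the Euler datum `B̃ = B` (this instance is the accepted
     `AveragingDatum.euler_isSymmetric` of `Literature/Analysis/FluidPDE/TaoAveragedSobolevProofs.lean`,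
     re-derived below as an `example`, not re-declared).
  3. (`symmetrize`, `symmetrize_isSymmetric`, `symmetrize_form`, `symmetrize_hasCancellation_iff`)
     every averaging datum `𝒜` has a **symmetrisation** inside Tao's class: enlarge `Ω` by a fair
     coin and, on heads, exchange the data of slots 1 and 2. Its form is symmetric
     unconditionally, equals `½(⟨B̃(u,v), w⟩ + ⟨B̃(v,u), w⟩)` whenever both averages converge
     absolutely (always the case on `H¹⁰_df`, Tao p. 7), and has the cancellation property iff
     `𝒜` has. This is the averaged-operator version of the symmetrisation
     `T = ½(T₁₂ + T₂₁)` of Tao's Remark 1.6; it shows that "symmetric" in Theorem 1.5 is a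
     normalisation available for free inside the class of averaged Euler operators.

Nothing in `TaoAveragedSobolev.lean` or `TaoAveragedSobolevProofs.lean` is modified or
re-declared. No Mathlib notion is duplicated (`lean search`: Mathlib has no averaged Euler
operators; the measure-theoretic tools used are `MeasurePreserving.integral_comp'`,
`MeasurableEmbedding.integral_map`/`lintegral_map`, `measurable_from_prod_countable_left`).

## References

* T. Tao, *Finite time blowup for an averaged three-dimensional Navier–Stokes equation*,
  J. Amer. Math. Soc. 29 (2016), 601–674, arXiv:1402.0290v3: §1.1 pp. 3, 6–7 ((1.12), (1.13),
  Remark 1.4, (1.16), Theorem 1.5, Remark 1.6); §4 p. 21. Key `Tao2016AveragedNS`.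
-/

noncomputable section

open MeasureTheory Set Filter
open scoped ENNReal

namespace Literature.Analysis.FluidPDE.Tao2016

namespace AveragingDatum

variable (𝒜 : AveragingDatum)

/-! ### An abstract symmetry criterion -/

/-- **Symmetry criterion for `B̃`.** If `σ` is a measurable automorphism of the sample space
preserving `μ` such that the random operator of slot 1 at `σ θ` is the operator of slot 2 at `θ`
and vice versa, while slot 3 is unchanged, then `⟨B̃(u,v), w⟩ = ⟨B̃(v,u), w⟩` for **all**
`u, v, w ∈ L²` (no regularity or integrability needed): by `⟨B(a,b), c⟩ = ⟨B(b,a), c⟩`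
(`eulerForm_symm`) and the change of variables `θ ↦ σ θ` in Tao's (1.13). (Cf. Tao 2016, §4,
p. 21, where the symmetry of the structure constants of `C` under the same transposition
"ensures that `C` is symmetric".) [folklore] -/
theorem form_symm_of_measurePreserving (σ : 𝒜.Ω ≃ᵐ 𝒜.Ω) (hσ : MeasurePreserving σ 𝒜.μ 𝒜.μ)
    (h₀ : ∀ θ, 𝒜.slot 0 (σ θ) = 𝒜.slot 1 θ) (h₁ : ∀ θ, 𝒜.slot 1 (σ θ) = 𝒜.slot 0 θ)
    (h₂ : ∀ θ, 𝒜.slot 2 (σ θ) = 𝒜.slot 2 θ) (u v w : L2C) :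
    𝒜.form u v w = 𝒜.form v u w := by
  unfold form
  rw [← hσ.integral_comp'
    (fun θ => eulerForm (𝒜.slot 0 θ u) (𝒜.slot 1 θ v) (𝒜.slot 2 θ w))]
  congr 1
  funext θ
  rw [h₀, h₁, h₂, eulerForm_symm]

/-- **Symmetry criterion for `B̃` on `H¹⁰_df`**: under the hypotheses of
`form_symm_of_measurePreserving`, `𝒜.IsSymmetric` (the hypothesis "symmetric" of Tao 2016,
Theorem 1.5) holds. [folklore] -/
theorem isSymmetric_of_measurePreserving (σ : 𝒜.Ω ≃ᵐ 𝒜.Ω) (hσ : MeasurePreserving σ 𝒜.μ 𝒜.μ)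
    (h₀ : ∀ θ, 𝒜.slot 0 (σ θ) = 𝒜.slot 1 θ) (h₁ : ∀ θ, 𝒜.slot 1 (σ θ) = 𝒜.slot 0 θ)
    (h₂ : ∀ θ, 𝒜.slot 2 (σ θ) = 𝒜.slot 2 θ) : 𝒜.IsSymmetric :=
  fun u v w _ _ _ => 𝒜.form_symm_of_measurePreserving σ hσ h₀ h₁ h₂ u v w

/-- A datum whose slot-1 and slot-2 operators coincide samplewise is symmetric (`σ = id`). [folklore] -/
theorem isSymmetric_of_slot_eq (h : ∀ θ, 𝒜.slot 0 θ = 𝒜.slot 1 θ) : 𝒜.IsSymmetric :=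
  𝒜.isSymmetric_of_measurePreserving (MeasurableEquiv.refl 𝒜.Ω) (MeasurePreserving.id 𝒜.μ)
    (fun θ => h θ) (fun θ => (h θ).symm) fun _ => rfl

/- The Euler datum (`mⱼ ≡ 1`, `Rⱼ = id`, `λⱼ = 1`, for which `B̃ = B`) is the case `σ = id`: all
its slots are the identity (`euler_slot`). This re-derives the accepted
`AveragingDatum.euler_isSymmetric` (`TaoAveragedSobolevProofs.lean`) from the criterion; it is an
`example`, not a second declaration of that name. -/
example : euler.IsSymmetric :=
  euler.isSymmetric_of_slot_eq fun θ => by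
    funext u
    rw [euler_slot, euler_slot]

/-! ### Symmetrisation of an averaging datum -/

/-- The slot relabelling used by the symmetrisation: the identity on tails (`false`), the
transposition of slots 1 and 2 (indices `0` and `1`) on heads (`true`). [folklore] -/
def swapSlot : Bool → Fin 3 → Fin 3
  | false, i => i
  | true, i => Equiv.swap 0 1 i

/-- `swapSlot false` is the identity. [folklore] -/
@[simp] theorem swapSlot_false (i : Fin 3) : swapSlot false i = i := rfl

/-- On heads, slot 1 becomes slot 2. [folklore] -/
@[simp] theorem swapSlot_true_zero : swapSlot true 0 = 1 := by decide

/-- On heads, slot 2 becomes slot 1. [folklore] -/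
@[simp] theorem swapSlot_true_one : swapSlot true 1 = 0 := by decide

/-- Slot 3 is never moved. [folklore] -/
@[simp] theorem swapSlot_true_two : swapSlot true 2 = 2 := by decide

/-- Flipping the coin exchanges the relabelled slots 1 and 2 … [folklore] -/
theorem swapSlot_not_zero (b : Bool) : swapSlot (!b) 0 = swapSlot b 1 := by
  cases b <;> decide

/-- … in both directions … [folklore] -/
theorem swapSlot_not_one (b : Bool) : swapSlot (!b) 1 = swapSlot b 0 := by
  cases b <;> decide

/-- … and fixes slot 3. [folklore] -/
theorem swapSlot_not_two (b : Bool) : swapSlot (!b) 2 = swapSlot b 2 := by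
  cases b <;> decide

/-- **Flipping the coin**: the measurable involution `(θ, b) ↦ (θ, ¬b)` of `Ω × Bool`. [folklore] -/
def flipCoin (Ω : Type) [MeasurableSpace Ω] : Ω × Bool ≃ᵐ Ω × Bool where
  toFun p := (p.1, !p.2)
  invFun p := (p.1, !p.2)
  left_inv p := by simp
  right_inv p := by simp
  measurable_toFun :=
    measurable_from_prod_countable_left (f := fun p : Ω × Bool => (p.1, !p.2)) fun b =>
      (measurable_id.prodMk measurable_const : Measurable fun θ : Ω => (θ, !b))
  measurable_invFun :=
    measurable_from_prod_countable_left (f := fun p : Ω × Bool => (p.1, !p.2)) fun b =>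
      (measurable_id.prodMk measurable_const : Measurable fun θ : Ω => (θ, !b))

/-- `flipCoin` acts as `(θ, b) ↦ (θ, ¬b)`. [folklore] -/
@[simp] theorem flipCoin_apply (Ω : Type) [MeasurableSpace Ω] (p : Ω × Bool) :
    flipCoin Ω p = (p.1, !p.2) := rfl

/-- `flipCoin` composed with the inclusion of a coin value is the inclusion of the other value. [folklore] -/
theorem flipCoin_comp_mk (Ω : Type) [MeasurableSpace Ω] (b : Bool) :
    (flipCoin Ω) ∘ (fun θ : Ω => (θ, b)) = fun θ => (θ, !b) := rfl

/-- **The sample space of the symmetrisation**: `μ ⊗ (fair coin)` on `Ω × Bool`, written as the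
average of the two push-forwards `θ ↦ (θ, false)`, `θ ↦ (θ, true)` of `μ` (so that no
product-measure or Fubini machinery is needed). [folklore] -/
def coinMeasure : Measure (𝒜.Ω × Bool) :=
  (2⁻¹ : ℝ≥0∞) • (𝒜.μ.map (fun θ => (θ, false)) + 𝒜.μ.map (fun θ => (θ, true)))

/-- `coinMeasure` is a probability measure. [folklore] -/
theorem isProbabilityMeasure_coinMeasure : IsProbabilityMeasure 𝒜.coinMeasure := by
  refine ⟨?_⟩
  have hf : Measurable fun θ : 𝒜.Ω => (θ, false) := measurable_id.prodMk measurable_const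
  have ht : Measurable fun θ : 𝒜.Ω => (θ, true) := measurable_id.prodMk measurable_const
  rw [coinMeasure, Measure.smul_apply, Measure.add_apply, Measure.map_apply hf MeasurableSet.univ,
    Measure.map_apply ht MeasurableSet.univ]
  simp only [Set.preimage_univ, measure_univ, smul_eq_mul]
  rw [one_add_one_eq_two]
  exact ENNReal.inv_mul_cancel two_ne_zero ENNReal.ofNat_ne_top

/-- **Lower integrals against `coinMeasure`** split as the average over the two coin values
(no measurability needed). [folklore] -/
theorem lintegral_coinMeasure (f : 𝒜.Ω × Bool → ℝ≥0∞) :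
    ∫⁻ p, f p ∂𝒜.coinMeasure =
      2⁻¹ * ((∫⁻ θ, f (θ, false) ∂𝒜.μ) + ∫⁻ θ, f (θ, true) ∂𝒜.μ) := by
  rw [coinMeasure, lintegral_smul_measure, lintegral_add_measure,
    (measurableEmbedding_prod_mk_right false).lintegral_map,
    (measurableEmbedding_prod_mk_right true).lintegral_map, smul_eq_mul]

/-- **Bochner integrals against `coinMeasure`** split as the average over the two coin values,
provided both halves are integrable. [folklore] -/
theorem integral_coinMeasure {E : Type*} [NormedAddCommGroup E] [NormedSpace ℝ E]
    (f : 𝒜.Ω × Bool → E) (hf : Integrable (fun θ => f (θ, false)) 𝒜.μ)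
    (ht : Integrable (fun θ => f (θ, true)) 𝒜.μ) :
    ∫ p, f p ∂𝒜.coinMeasure =
      (2⁻¹ : ℝ) • ((∫ θ, f (θ, false) ∂𝒜.μ) + ∫ θ, f (θ, true) ∂𝒜.μ) := by
  have ef := measurableEmbedding_prod_mk_right (β := 𝒜.Ω) false
  have et := measurableEmbedding_prod_mk_right (β := 𝒜.Ω) true
  rw [coinMeasure, integral_smul_measure, integral_add_measure (ef.integrable_map_iff.2 hf)
    (et.integrable_map_iff.2 ht), ef.integral_map, et.integral_map, ENNReal.toReal_inv,
    ENNReal.toReal_ofNat]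

/-- **Integrability against `coinMeasure`** is integrability of both halves. [folklore] -/
theorem integrable_coinMeasure_iff {E : Type*} [NormedAddCommGroup E] (f : 𝒜.Ω × Bool → E) :
    Integrable f 𝒜.coinMeasure ↔
      Integrable (fun θ => f (θ, false)) 𝒜.μ ∧ Integrable (fun θ => f (θ, true)) 𝒜.μ := by
  rw [coinMeasure, integrable_smul_measure (by simp) (by simp), integrable_add_measure,
    (measurableEmbedding_prod_mk_right false).integrable_map_iff,
    (measurableEmbedding_prod_mk_right true).integrable_map_iff]
  rfl

/-- A coin-independent integrand integrates against `coinMeasure` as against `μ`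
(unconditionally: both sides vanish together when not integrable). [folklore] -/
theorem integral_coinMeasure_comp_fst {E : Type*} [NormedAddCommGroup E] [NormedSpace ℝ E]
    (f : 𝒜.Ω → E) : ∫ p, f p.1 ∂𝒜.coinMeasure = ∫ θ, f θ ∂𝒜.μ := by
  by_cases hf : Integrable f 𝒜.μ
  · rw [𝒜.integral_coinMeasure (fun p => f p.1) hf hf, ← two_smul ℝ (∫ θ, f θ ∂𝒜.μ), smul_smul]
    norm_num
  · rw [integral_undef hf, integral_undef]
    rw [integrable_coinMeasure_iff]
    exact fun h => hf h.1

/-- **Flipping the coin preserves `coinMeasure`.** [folklore] -/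
theorem measurePreserving_flipCoin :
    MeasurePreserving (flipCoin 𝒜.Ω) 𝒜.coinMeasure 𝒜.coinMeasure where
  measurable := (flipCoin 𝒜.Ω).measurable
  map_eq := by
    have hf : Measurable fun θ : 𝒜.Ω => (θ, false) := measurable_id.prodMk measurable_const
    have ht : Measurable fun θ : 𝒜.Ω => (θ, true) := measurable_id.prodMk measurable_const
    rw [coinMeasure, Measure.map_smul, Measure.map_add _ _ (flipCoin 𝒜.Ω).measurable,
      Measure.map_map (flipCoin 𝒜.Ω).measurable hf,
      Measure.map_map (flipCoin 𝒜.Ω).measurable ht, flipCoin_comp_mk, flipCoin_comp_mk,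
      Bool.not_false, Bool.not_true, add_comm]

/-- **The symmetrisation of an averaging datum** (Tao's class (1.12)/(1.13) is closed under it):
sample space `Ω × Bool` with `μ ⊗ (fair coin)`; on tails the data `(mⱼ, Rⱼ, λⱼ)` of `𝒜`, on heads
the same data with slots 1 and 2 exchanged. All of Tao's requirements (real order-`0` symbols,
`SO(3)` rotations, `λ ∈ [C⁻¹, C]`, the moment bounds, measurability) are inherited. Its form is
`½(⟨B̃(u,v), w⟩ + ⟨B̃(v,u), w⟩)` (`symmetrize_form`), the averaged analogue of
`T = ½(T₁₂ + T₂₁)` in Tao 2016, Remark 1.6. [folklore] -/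
def symmetrize : AveragingDatum where
  Ω := 𝒜.Ω × Bool
  μ := 𝒜.coinMeasure
  isProb := 𝒜.isProbabilityMeasure_coinMeasure
  m i p := 𝒜.m (swapSlot p.2 i) p.1
  R i p := 𝒜.R (swapSlot p.2 i) p.1
  lam i p := 𝒜.lam (swapSlot p.2 i) p.1
  isRealSymbol i p := 𝒜.isRealSymbol _ _
  det_R i p := 𝒜.det_R _ _
  lam_pos i p := 𝒜.lam_pos _ _
  lam_bdd := by
    obtain ⟨C, hC⟩ := 𝒜.lam_bdd
    exact ⟨C, fun i p => hC _ _⟩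
  moment k₁ k₂ k₃ := by
    rw [lintegral_coinMeasure]
    refine ENNReal.mul_lt_top (by simp) (ENNReal.add_lt_top.2 ⟨?_, ?_⟩)
    · simpa using 𝒜.moment k₁ k₂ k₃
    · have h := 𝒜.moment k₂ k₁ k₃
      simp only [swapSlot_true_zero, swapSlot_true_one, swapSlot_true_two]
      refine lt_of_le_of_lt (le_of_eq (lintegral_congr fun θ => ?_)) h
      ring
  measurable_m i ξ hξ :=
    measurable_from_prod_countable_left fun b => 𝒜.measurable_m (swapSlot b i) ξ hξ
  measurable_R i x := measurable_from_prod_countable_left fun b => 𝒜.measurable_R (swapSlot b i) x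
  measurable_lam i := measurable_from_prod_countable_left fun b => 𝒜.measurable_lam (swapSlot b i)

/-- The random operators of the symmetrisation are those of `𝒜`, relabelled by the coin. [folklore] -/
theorem symmetrize_slot (i : Fin 3) (θ : 𝒜.Ω) (b : Bool) :
    𝒜.symmetrize.slot i (θ, b) = 𝒜.slot (swapSlot b i) θ := rfl

/-- **The symmetrisation is symmetric**: `𝒜.symmetrize.IsSymmetric` for every averaging datum
`𝒜` (flip the coin: `isSymmetric_of_measurePreserving` with `σ = flipCoin`). Hence the
"symmetric" in Tao 2016, Theorem 1.5 costs nothing inside the class of averaged Euler bilinear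
operators. [folklore] -/
theorem symmetrize_isSymmetric : 𝒜.symmetrize.IsSymmetric := by
  refine 𝒜.symmetrize.isSymmetric_of_measurePreserving (flipCoin 𝒜.Ω)
    𝒜.measurePreserving_flipCoin ?_ ?_ ?_
  · rintro ⟨θ, b⟩
    change 𝒜.slot (swapSlot (!b) 0) θ = 𝒜.slot (swapSlot b 1) θ
    rw [swapSlot_not_zero]
  · rintro ⟨θ, b⟩
    change 𝒜.slot (swapSlot (!b) 1) θ = 𝒜.slot (swapSlot b 0) θ
    rw [swapSlot_not_one]
  · rintro ⟨θ, b⟩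
    change 𝒜.slot (swapSlot (!b) 2) θ = 𝒜.slot (swapSlot b 2) θ
    rw [swapSlot_not_two]

/-- **The symmetrisation is the average `½(B̃ + B̃ᵀ)`**:
`⟨B̃ˢʸᵐ(u,v), w⟩ = ½(⟨B̃(u,v), w⟩ + ⟨B̃(v,u), w⟩)` whenever both averages (1.13) converge
absolutely (which is always the case for `u, v, w ∈ H¹⁰_df`, Tao 2016, p. 7; stated here as a
hypothesis because absolute convergence is not formalised). [folklore] -/
theorem symmetrize_form (u v w : L2C)
    (huv : Integrable (fun θ => eulerForm (𝒜.slot 0 θ u) (𝒜.slot 1 θ v) (𝒜.slot 2 θ w)) 𝒜.μ)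
    (hvu : Integrable (fun θ => eulerForm (𝒜.slot 0 θ v) (𝒜.slot 1 θ u) (𝒜.slot 2 θ w)) 𝒜.μ) :
    𝒜.symmetrize.form u v w = (2⁻¹ : ℂ) * (𝒜.form u v w + 𝒜.form v u w) := by
  have hfalse : (fun θ => eulerForm (𝒜.symmetrize.slot 0 (θ, false) u)
      (𝒜.symmetrize.slot 1 (θ, false) v) (𝒜.symmetrize.slot 2 (θ, false) w)) =
      fun θ => eulerForm (𝒜.slot 0 θ u) (𝒜.slot 1 θ v) (𝒜.slot 2 θ w) := rfl
  have htrue : (fun θ => eulerForm (𝒜.symmetrize.slot 0 (θ, true) u)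
      (𝒜.symmetrize.slot 1 (θ, true) v) (𝒜.symmetrize.slot 2 (θ, true) w)) =
      fun θ => eulerForm (𝒜.slot 0 θ v) (𝒜.slot 1 θ u) (𝒜.slot 2 θ w) := by
    funext θ
    simp only [symmetrize_slot, swapSlot_true_zero, swapSlot_true_one, swapSlot_true_two]
    exact eulerForm_symm _ _ _
  have h := 𝒜.integral_coinMeasure
    (fun p : 𝒜.Ω × Bool => eulerForm (𝒜.symmetrize.slot 0 p u) (𝒜.symmetrize.slot 1 p v)
      (𝒜.symmetrize.slot 2 p w))
    (by rw [hfalse]; exact huv) (by rw [htrue]; exact hvu)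
  rw [hfalse, htrue] at h
  refine h.trans ?_
  rw [Complex.real_smul]
  push_cast
  rfl

/-- On the diagonal the symmetrisation changes nothing: `⟨B̃ˢʸᵐ(u,u), u⟩ = ⟨B̃(u,u), u⟩`
(unconditionally). [folklore] -/
theorem symmetrize_form_self (u : L2C) : 𝒜.symmetrize.form u u u = 𝒜.form u u u := by
  have key : ∀ p : 𝒜.Ω × Bool,
      eulerForm (𝒜.symmetrize.slot 0 p u) (𝒜.symmetrize.slot 1 p u) (𝒜.symmetrize.slot 2 p u) =
      eulerForm (𝒜.slot 0 p.1 u) (𝒜.slot 1 p.1 u) (𝒜.slot 2 p.1 u) := by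
    rintro ⟨θ, b⟩
    cases b
    · rfl
    · simp only [symmetrize_slot, swapSlot_true_zero, swapSlot_true_one, swapSlot_true_two]
      exact eulerForm_symm _ _ _
  have h : ∫ p, eulerForm (𝒜.symmetrize.slot 0 p u) (𝒜.symmetrize.slot 1 p u)
      (𝒜.symmetrize.slot 2 p u) ∂𝒜.coinMeasure =
      ∫ p, eulerForm (𝒜.slot 0 p.1 u) (𝒜.slot 1 p.1 u) (𝒜.slot 2 p.1 u) ∂𝒜.coinMeasure :=
    integral_congr_ae (Eventually.of_forall key)
  exact h.trans (𝒜.integral_coinMeasure_comp_fst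
    fun θ => eulerForm (𝒜.slot 0 θ u) (𝒜.slot 1 θ u) (𝒜.slot 2 θ u))

/-- **The symmetrisation has the cancellation property (1.16) iff `𝒜` has.** [folklore] -/
theorem symmetrize_hasCancellation_iff : 𝒜.symmetrize.HasCancellation ↔ 𝒜.HasCancellation :=
  forall₂_congr fun u _ => by rw [symmetrize_form_self]

end AveragingDatum

end Literature.Analysis.FluidPDE.Tao2016
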